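/-
HODGE LADDER — STAGE 4: the strict road (S) — DOMINATION IS TRANSITIVE, and row 4 (Fermat hypersurfaces) WITH
ALL POWERS AND PRODUCTS from `HC_AV` modulo the Shioda–Katsura domination.  Arapura 2006 §1: "`Y` is motivated by
`X` if the motive of `Y` is contained in the category generated from `X` by taking sums, summands and products" —
a transitive relation; on the tree's real carriers (`HodgeTheory.IsDominatedByPowers`, algebraic form of Arapura's
Lemma 1.1): `Y` dominated by the powers of `Z` and `Z` dominated by the powers of `A` ⟹ `Y` dominated by the powers
of `A` (composites of algebraic correspondences are algebraic).  Hence `HC_AV` ALONE gives the Hodge conjecture,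
with all powers, for every smooth projective complex variety dominated by the powers of a CURVE, of a power or a
product of curves, or of any variety itself dominated by an abelian variety (Shioda–Katsura 1979 Cor. 1.11 / §3:
the Fermat hypersurface `Xⁿₘ` and the Fermat curve `X¹ₘ`; Schoen 1996: varieties dominated by product varieties)
— KERNEL theorems, NO Literature record; the geometric domination is a displayed hypothesis (literature seat
hodge-director-lit-stage4, gen 13).  Theorems only: no definition, no named fact, no new target.  Companion document
run/shared/lean/pub/hodge-director/STAGE4-ABELIAN-MOTIVIC-TYPE.md (v13, §16).
-/
import Summits.HodgeConjecture.CorCM.Stage4StrictRoadSurjections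
import Literature.AlgebraicGeometry.HodgeTheory.FermatHypersurfaceReduction
import HarnessLib

/-!
# Stage 4 — the strict road: transitivity of domination; Fermat hypersurfaces with all powers and products

`CorCM/Stage4StrictRoadCurves` (gen 12) typed the base of Arapura's strong motivation by an abelian variety — a
smooth projective complex curve is dominated by the powers of its Jacobian (Arapura 2006 §1 Lemma 1.3), products of
dominated varieties are dominated — and `CorCM/Stage4StrictRoadSurjections` the descent of domination along
surjective morphisms (Cor. 1.2).  This file adds the remaining closure property of the printed notion: D. Arapura,
*Motivation for Hodge cycles*, Adv. Math. 207 (2006), Introduction (p. 762): "we say that `X` motivates `Y` or that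
`Y` is motivated by `X` if the motive of `Y` is contained in the category generated from `X` by taking sums,
summands and products" — so "motivated by" is TRANSITIVE (the category generated from `Z` lies in the category
generated from `X` as soon as `[Z]` does, the latter being a tensor category: §1, "`M_A(𝒱)` the tensor category
generated by these motives").  On the real carriers (`IsDominatedByPowers dY Y dZ Z`: every `Hᵏ(Y(ℂ); ℂ)` is the
`ℂ`-span of the images of algebraic correspondences from the cartesian powers `Zᵉ`):

* `isDominatedByPowers_pow` — all powers `Zᵉ`, `e ≥ 0`, of a variety dominated by the powers of `A` are dominated
  by the powers of `A` (`e = 0`: the point, `isDominatedByPowers_unit`; `e ≥ 1`: `isDominatedByPowers_pow_succ`,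
  gen 7);
* `isDominatedByPowers_trans` — **transitivity**: `Y` dominated by the powers of `Z`, `Z` dominated by the powers of
  `A` ⟹ `Y` dominated by the powers of `A` (each generator `T x`, `T` algebraic from `Zᵉ`, has `x` in the span of
  values `S w` of algebraic correspondences `S` from powers `Aᶠ`, and `T ∘ S` is algebraic:
  `IsAlgebraicCorrespondence.comp`, Fulton Prop. 16.1.1 on the real carriers);
  `exists_isDominatedByPowers_of_isDominatedByPowers` (existential packaging over abelian varieties);
* from `HC_AV` ALONE (Arapura Lemma 4.2 = the kernel theorem `hc_of_isDominatedByPowers_abelianVariety_holds`):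
  `hc_of_isDominatedByPowers_of_exists` (any `Z` dominated by some abelian variety),
  `hc_of_isDominatedByPowers_curve` (**varieties dominated by the powers of a smooth projective curve**),
  `hc_of_isDominatedByPowers_curve_pow` (by the powers of `Cʳ`), `hc_of_isDominatedByPowers_curve_tensor_curve`
  (by the powers of `C₁ × C₂`), `hc_of_isDominatedByPowers_tensor` (by the powers of a product `Z ⊗ Z'` of two
  varieties each dominated by an abelian variety) — the Hodge conjecture for `Y` AND all its powers;
* **row 4 of the scoping document with all powers and products** (T. Shioda, *The Hodge conjecture and the Tate
  conjecture for Fermat varieties*, Proc. Japan Acad. 55 A (1979), no. 3, 111–114, Thm. 2 (p. 112): "Fix `m > 1`.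
  If the condition (P̃ₘ) is satisfied, then the Hodge Conjecture for arbitrary product `Xⁿ¹ₘ × ⋯ × Xⁿᵏₘ` is true";
  §4 (p. 114): "The proof of Theorems 2 and 4 also depends on the existence of the isomorphism (*) preserving
  algebraic cycles"; T. Shioda, T. Katsura, *On Fermat varieties*, Tôhoku Math. J. 31 (1979), Cor. 1.11
  (p. 102–103): "For any `r ≥ 1`, there exist rational maps of finite degree `X¹ₘ × ⋯ × X¹ₘ` (`r` times) `→ Xʳₘ`",
  §3 (p. 107–108): "the vector space `Hʳ(Xʳₘ)` can be naturally considered as a subspace of a direct sum of spaces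
  of the form `H¹(X¹ₘ)^{⊗r'}` with `r' ≤ r`, as is easily seen from Corollary 2.5 by induction on `r`", Remark 2.11
  (p. 107): "we can reduce it to the corresponding conjecture for the self-products of the Fermat curve `X¹ₘ` of
  dimensions up to `r`"): GIVEN `HC_AV`, and GIVEN the domination of the standard model `Xⁿₘ` by the powers of the
  Fermat curve `X¹ₘ` through algebraic correspondences (the cycle form of Shioda–Katsura's inductive structure
  Thm. 1.7 / Cor. 2.5 — NOT in the tree: it needs blow-ups of smooth projective `ℂ`-schemes and the blow-up formula
  Lemma 2.1 on `H*(–(ℂ); ℂ)`, the same input the tree's `FermatCohomologyCurvePowerDomination` takes as the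
  hypotheses `hA`/`hB`; displayed here as the hypothesis `hSK : IsDominatedByPowers n (Xⁿₘ) 1 (X¹ₘ)`), the Hodge
  conjecture holds for `Xⁿₘ`, for every Fermat variety `X ≅ Xⁿₘ`, for ALL POWERS `(Xⁿₘ)^{k+1}`, and for the products
  `Xⁿ¹_{m₁} × Xⁿ²_{m₂}` of Fermat hypersurfaces of ANY two degrees with all their powers
  (`hc_fermatHypersurface_powers_of_hc_av`, `hc_of_isFermatVariety_of_hc_av`,
  `hc_fermatHypersurface_tensor_powers_of_hc_av`).  Beyond `HC_AV`: nothing — and the `HC_AV` instance consumed is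
  the Hodge conjecture for the powers of a product of Fermat Jacobians (CM abelian varieties, Koblitz–Rohrlich), the
  open content sitting in dimension `≥ 4` (`hc_av_iff_forall_four_le`, `CorCM/Stage4OpenSlices`).

Nothing is asserted about `HC_AV` or about the Shioda–Katsura domination. [cite: Arapura2006, Introduction (p. 762), §1 Lemma 1.1, Lemma 1.3 and §4 Lemma 4.2]
[cite: ShiodaKatsura1979, §1 Thm. 1.7, Cor. 1.11, §2 Lemma 2.1, Cor. 2.5, Remark 2.11 and §3 (p. 107–108)]
[cite: Shioda1979PJA, §2 Thm. 1, Thm. 2 and §4] [cite: Fulton1998, §16.1 Def. 16.1.1 and Prop. 16.1.1]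

## References
* [Arapura2006] D. Arapura, *Motivation for Hodge cycles*, Adv. Math. 207 (2006), no. 2, 762–781
  (doi 10.1016/j.aim.2006.01.005; arXiv math/0501348), Introduction, §1 Lemma 1.1, Cor. 1.2, Lemma 1.3, §4 Lemma 4.2.
* [ShiodaKatsura1979] T. Shioda, T. Katsura, *On Fermat varieties*, Tôhoku Math. J. (2) 31 (1979), no. 1, 97–115
  (doi 10.2748/tmj/1178229881), §1 Thm. 1.7 (1.25), Cor. 1.11 (1.26); §2 Lemma 2.1, Prop. 2.4, Cor. 2.5 (2.9),
  Remark 2.11; §3 p. 107–108.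
* [Shioda1979PJA] T. Shioda, *The Hodge conjecture and the Tate conjecture for Fermat varieties*, Proc. Japan Acad.
  Ser. A Math. Sci. 55 (1979), no. 3, 111–114 (doi 10.3792/pjaa.55.111), §2 Thm. 1, Thm. 2; §4.
* [Fulton1998] W. Fulton, *Intersection Theory*, 2nd ed., Springer (1998), §16.1 Def. 16.1.1, Prop. 16.1.1.
* [Hartshorne1977] R. Hartshorne, *Algebraic Geometry*, Springer GTM 52 (1977), I Ex. 5.5, II Example 8.20.2.
-/

noncomputable section

namespace Summit.HodgeConjecture.CorCM.Stage4

open CategoryTheory MonoidalCategory CartesianMonoidalCategory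
open Literature.AlgebraicGeometry Literature.AlgebraicGeometry.Motives Literature.AlgebraicGeometry.HodgeTheory
open Literature.AlgebraicTopology.SingularHomology
open Summit.HodgeConjecture.HodgeConjecture.Ring2.AbelianAll (IsAlgebraicCorrespondence.comp)

/-! ## §1 Transitivity of domination -/

section Transitivity

variable {dA dZ dY : ℕ} {A Z Y : SchemeOver ℂ}

/-- **All cartesian powers `Zᵉ`, `e ≥ 0`, of a variety dominated by the powers of `A` are dominated by the powers of
`A`**: the point `Z⁰ = Spec ℂ` by `isDominatedByPowers_unit`, the positive powers by `isDominatedByPowers_pow_succ`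
(products of dominated varieties are dominated, `CorCM/Stage4StrictRoadDischargePowers`).
[cite: Arapura2006, §1 Lemma 1.1 and §4 Lemma 4.2] -/
theorem isDominatedByPowers_pow (hA : IsSmoothProjective dA A) (hZ : IsSmoothProjective dZ Z)
    (hZA : IsDominatedByPowers dZ Z dA A) : ∀ e : ℕ, IsDominatedByPowers (e * dZ) (Z.pow e) dA A
  | 0 => by
    rw [Nat.zero_mul, SchemeOver.pow_zero]
    exact isDominatedByPowers_unit hA
  | e + 1 => isDominatedByPowers_pow_succ hA hZ hZA e

/-- **Domination is transitive** (Arapura 2006, Introduction: "`Y` is motivated by `X` if the motive of `Y` is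
contained in the category generated from `X` by taking sums, summands and products" — the category generated from
`Z` lies in the one generated from `A` once `[Z]` does; on the real carriers and in the algebraic form of Lemma 1.1):
if every `Hᵏ(Y(ℂ); ℂ)` is spanned by the images of algebraic correspondences from the powers `Zᵉ`, and every
`Hᵃ(Z(ℂ); ℂ)` by the images of algebraic correspondences from the powers `Aᶠ`, then every `Hᵏ(Y(ℂ); ℂ)` is spanned
by the images of algebraic correspondences from the powers `Aᶠ`.  Proof: a generator `T x` (`T` algebraic from
`Zᵉ`) has `x` in the span of the values `S w` of algebraic correspondences `S` from powers `Aᶠ` (`Zᵉ` is dominated: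
`isDominatedByPowers_pow`), `T` is linear, and `T ∘ S` is an algebraic correspondence from `Aᶠ` to `Y`
(`IsAlgebraicCorrespondence.comp`: composites of correspondences, Fulton Def. 16.1.1 / Prop. 16.1.1 on the real
carriers). [cite: Arapura2006, Introduction (p. 762), §1 Lemma 1.1 and §4 Lemma 4.2]
[cite: Fulton1998, §16.1 Def. 16.1.1 and Prop. 16.1.1] -/
theorem isDominatedByPowers_trans (hA : IsSmoothProjective dA A) (hZ : IsSmoothProjective dZ Z)
    (hY : IsSmoothProjective dY Y) (hYZ : IsDominatedByPowers dY Y dZ Z) (hZA : IsDominatedByPowers dZ Z dA A) :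
    IsDominatedByPowers dY Y dA A := by
  intro k
  refine eq_top_iff.2 ((hYZ k).symm.le.trans (Submodule.span_le.2 ?_))
  rintro _ ⟨e, a, T, hT, x, rfl⟩
  rw [SetLike.mem_coe]
  -- `x ∈ Hᵃ(Zᵉ(ℂ))` lies in the span of the images of algebraic correspondences from the powers of `A`
  have hx : x ∈ Submodule.span ℂ
      {c : complexBetti (Z.pow e) a |
        ∃ (f b : ℕ) (S : complexBetti (A.pow f) b →ₗ[ℂ] complexBetti (Z.pow e) a),
          IsAlgebraicCorrespondence (e * dZ) (f * dA) (Z.pow e) (A.pow f) S ∧ c ∈ LinearMap.range S} := by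
    rw [isDominatedByPowers_pow hA hZ hZA e a]
    exact Submodule.mem_top
  -- the image of that span under `T` lies in the `Y`-span: `T ∘ S` is algebraic
  have key : Submodule.map T (Submodule.span ℂ
      {c : complexBetti (Z.pow e) a |
        ∃ (f b : ℕ) (S : complexBetti (A.pow f) b →ₗ[ℂ] complexBetti (Z.pow e) a),
          IsAlgebraicCorrespondence (e * dZ) (f * dA) (Z.pow e) (A.pow f) S ∧ c ∈ LinearMap.range S}) ≤
      Submodule.span ℂ
        {c : complexBetti Y k |
          ∃ (f b : ℕ) (S : complexBetti (A.pow f) b →ₗ[ℂ] complexBetti Y k),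
            IsAlgebraicCorrespondence dY (f * dA) Y (A.pow f) S ∧ c ∈ LinearMap.range S} := by
    refine (Submodule.map_span_le _ _ _).2 ?_
    rintro _ ⟨f, b, S, hS, w, rfl⟩
    by_cases hb : b ≤ 2 * (f * dA)
    swap
    · haveI := subsingleton_complexBetti (hA.pow f) (k := b) (by omega)
      rw [Subsingleton.elim w 0, map_zero, map_zero]
      exact Submodule.zero_mem _
    exact Submodule.subset_span ⟨f, b, T ∘ₗ S,
      IsAlgebraicCorrespondence.comp hY (hZ.pow e) (hA.pow f) hS hT (by omega), w, rfl⟩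
  exact key (Submodule.mem_map_of_mem hx)

/-- Existential packaging over abelian varieties: `Y` dominated by the powers of `Z`, and `Z` dominated by (the
powers of) SOME complex abelian variety ⟹ `Y` is dominated by (the powers of) that abelian variety.
[cite: Arapura2006, Introduction (p. 762) and §1 Lemma 1.1] -/
theorem exists_isDominatedByPowers_of_isDominatedByPowers (hZ : IsSmoothProjective dZ Z)
    (hY : IsSmoothProjective dY Y) (hYZ : IsDominatedByPowers dY Y dZ Z)
    (h : ∃ B : AbelianVariety ℂ, IsDominatedByPowers dZ Z B.dim B.X) :
    ∃ B : AbelianVariety ℂ, IsDominatedByPowers dY Y B.dim B.X := by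
  obtain ⟨B, hB⟩ := h
  exact ⟨B, isDominatedByPowers_trans AbelianVariety.isSmoothProjective_holds hZ hY hYZ hB⟩

/-- Existential packaging, all powers: `Z` dominated by SOME abelian variety ⟹ so is every cartesian power `Zᵉ`,
`e ≥ 0` (the point `Z⁰` included). [cite: Arapura2006, §1 Lemma 1.1 and §4 Lemma 4.2] -/
theorem exists_isDominatedByPowers_pow (hZ : IsSmoothProjective dZ Z)
    (h : ∃ B : AbelianVariety ℂ, IsDominatedByPowers dZ Z B.dim B.X) (e : ℕ) :
    ∃ B : AbelianVariety ℂ, IsDominatedByPowers (e * dZ) (Z.pow e) B.dim B.X := by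
  obtain ⟨B, hB⟩ := h
  exact ⟨B, isDominatedByPowers_pow AbelianVariety.isSmoothProjective_holds hZ hB e⟩

end Transitivity

/-! ## §2 Consequences from `HC_AV` alone: varieties dominated by curves, by powers and products of curves -/

section Consequences

variable {dZ dZ' dY : ℕ} {Z Z' Y C C₁ C₂ : SchemeOver ℂ}

/-- **`HC_AV` ⟹ the Hodge conjecture for every smooth projective complex variety dominated by the powers of a
variety `Z` that is itself dominated by an abelian variety, and for all its powers** (Arapura 2006 Lemma 4.2, kernel
form `hc_of_isDominatedByPowers_abelianVariety_holds`, composed with transitivity).  Sources `Z` in the tree: curves,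
abelian varieties, their finite products and powers, smooth surjective images of these (`CorCM/Stage4StrictRoadCurves`,
`CorCM/Stage4StrictRoadSurjections`). [cite: Arapura2006, §1 Lemma 1.1, Lemma 1.3 and §4 Lemma 4.2] -/
theorem hc_of_isDominatedByPowers_of_exists (hAV : HC_AV) (hZ : IsSmoothProjective dZ Z)
    (hY : IsSmoothProjective dY Y) (hYZ : IsDominatedByPowers dY Y dZ Z)
    (h : ∃ B : AbelianVariety ℂ, IsDominatedByPowers dZ Z B.dim B.X) :
    HodgeConjectureFor dY Y ∧ ∀ m : ℕ, HodgeConjectureFor ((m + 1) * dY) (Y.pow (m + 1)) :=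
  hc_of_exists_isDominatedByPowers_abelianVariety hAV hY
    (exists_isDominatedByPowers_of_isDominatedByPowers hZ hY hYZ h)

/-- **`HC_AV` ⟹ the Hodge conjecture, with all powers, for every smooth projective complex variety dominated by the
powers of a smooth projective CURVE** (the curve is dominated by the powers of its Jacobian, Arapura 2006 Lemma 1.3
— `exists_isDominatedByPowers_curve`, no record —, and domination is transitive).  Instance in print: the Fermat
hypersurface `Xⁿₘ` and the Fermat curve `X¹ₘ` (Shioda–Katsura 1979 §3; §3 of this file).
[cite: Arapura2006, §1 Lemma 1.1, Lemma 1.3 and §4 Lemma 4.2] [cite: ShiodaKatsura1979, §3 (p. 107–108)] -/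
theorem hc_of_isDominatedByPowers_curve (hAV : HC_AV) (hC : IsSmoothProjective 1 C) (hY : IsSmoothProjective dY Y)
    (hdom : IsDominatedByPowers dY Y 1 C) :
    HodgeConjectureFor dY Y ∧ ∀ m : ℕ, HodgeConjectureFor ((m + 1) * dY) (Y.pow (m + 1)) :=
  hc_of_isDominatedByPowers_of_exists hAV hC hY hdom (exists_isDominatedByPowers_curve hC)

/-- **`HC_AV` ⟹ the Hodge conjecture, with all powers, for every smooth projective complex variety dominated by the
powers of a power `Cʳ` of a smooth projective curve** (Shioda–Katsura 1979 Cor. 1.11: "rational maps of finite degree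
`X¹ₘ × ⋯ × X¹ₘ → Xʳₘ`"; Schoen 1996, varieties dominated by product varieties — here in the cohomological form of
Arapura's Lemma 1.1, the geometric domination being the user's input).
[cite: Arapura2006, §1 Lemma 1.1, Lemma 1.3 and §4 Lemma 4.2] [cite: ShiodaKatsura1979, §1 Cor. 1.11] -/
theorem hc_of_isDominatedByPowers_curve_pow (hAV : HC_AV) (hC : IsSmoothProjective 1 C)
    (hY : IsSmoothProjective dY Y) {r : ℕ} (hdom : IsDominatedByPowers dY Y r (C.pow r)) :
    HodgeConjectureFor dY Y ∧ ∀ m : ℕ, HodgeConjectureFor ((m + 1) * dY) (Y.pow (m + 1)) := by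
  have hCr : IsSmoothProjective (r * 1) (C.pow r) := hC.pow r
  obtain ⟨B, hB⟩ := exists_isDominatedByPowers_pow hC (exists_isDominatedByPowers_curve hC) r
  rw [Nat.mul_one] at hCr hB
  exact hc_of_isDominatedByPowers_of_exists hAV hCr hY hdom ⟨B, hB⟩

/-- **`HC_AV` ⟹ the Hodge conjecture, with all powers, for every smooth projective complex variety dominated by the
powers of a product `C₁ × C₂` of two smooth projective curves.** [cite: Arapura2006, §1 Lemma 1.1, Lemma 1.3 and §4 Lemma 4.2] -/
theorem hc_of_isDominatedByPowers_curve_tensor_curve (hAV : HC_AV) (hC₁ : IsSmoothProjective 1 C₁)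
    (hC₂ : IsSmoothProjective 1 C₂) (hY : IsSmoothProjective dY Y)
    (hdom : IsDominatedByPowers dY Y 2 (C₁ ⊗ C₂)) :
    HodgeConjectureFor dY Y ∧ ∀ m : ℕ, HodgeConjectureFor ((m + 1) * dY) (Y.pow (m + 1)) := by
  have hCC : IsSmoothProjective (1 + 1) (C₁ ⊗ C₂) := hC₁.tensor_holds hC₂
  have h := exists_isDominatedByPowers_tensor hC₁ hC₂ (exists_isDominatedByPowers_curve hC₁)
    (exists_isDominatedByPowers_curve hC₂)
  rw [show (1 : ℕ) + 1 = 2 from rfl] at hCC h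
  exact hc_of_isDominatedByPowers_of_exists hAV hCC hY hdom h

/-- **`HC_AV` ⟹ the Hodge conjecture, with all powers, for every smooth projective complex variety dominated by the
powers of a product `Z ⊗ Z'` of two varieties each dominated by an abelian variety** (curves, abelian varieties,
their products and powers, smooth images: the closure lemmas of the strict road).
[cite: Arapura2006, §1 Lemma 1.1 and §4 Lemma 4.2] -/
theorem hc_of_isDominatedByPowers_tensor (hAV : HC_AV) (hZ : IsSmoothProjective dZ Z)
    (hZ' : IsSmoothProjective dZ' Z') (hY : IsSmoothProjective dY Y)
    (h : ∃ B : AbelianVariety ℂ, IsDominatedByPowers dZ Z B.dim B.X)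
    (h' : ∃ B : AbelianVariety ℂ, IsDominatedByPowers dZ' Z' B.dim B.X)
    (hdom : IsDominatedByPowers dY Y (dZ + dZ') (Z ⊗ Z')) :
    HodgeConjectureFor dY Y ∧ ∀ m : ℕ, HodgeConjectureFor ((m + 1) * dY) (Y.pow (m + 1)) :=
  hc_of_isDominatedByPowers_of_exists hAV (hZ.tensor_holds hZ') hY hdom (exists_isDominatedByPowers_tensor hZ hZ' h h')

end Consequences

/-! ## §3 Row 4: Fermat hypersurfaces with all powers and products, from `HC_AV` modulo the Shioda–Katsura
domination -/

section Fermat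

variable {n n₁ n₂ m m₁ m₂ : ℕ} {X : SchemeOver ℂ}

/-- **Row 4 with all powers (Shioda 1979, Proc. Japan Acad. 55 A, Thm. 2: "the Hodge Conjecture for arbitrary
product `Xⁿ¹ₘ × ⋯ × Xⁿᵏₘ`", under his arithmetic condition; here from `HC_AV`):** GIVEN `HC_AV`, and GIVEN that the
standard model `Xⁿₘ = V₊(Σ xᵢᵐ) ⊂ ℙⁿ⁺¹` (`fermatHypersurface n m`, `n, m ≥ 1`) is dominated by the powers of the
Fermat curve `X¹ₘ` through algebraic correspondences — Shioda–Katsura 1979 §3: "`Hʳ(Xʳₘ)` can be naturally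
considered as a subspace of a direct sum of spaces of the form `H¹(X¹ₘ)^{⊗r'}` with `r' ≤ r`", obtained from the
inductive structure Thm. 1.7 / Cor. 2.5 by the correspondences of the diagram (1.25) (blow-up, `μₘ`-quotient,
blow-down); NOT a tree theorem (the blow-up formula Lemma 2.1 on the real carriers is missing), hence the displayed
hypothesis `hSK` — the Hodge conjecture holds for `Xⁿₘ` and for ALL ITS POWERS `(Xⁿₘ)^{k+1}`.  Beyond `HC_AV`:
nothing (the curve is dominated by its Jacobian, `hc_of_isDominatedByPowers_curve`).
[cite: Shioda1979PJA, §2 Thm. 2 and §4 (p. 114)] [cite: ShiodaKatsura1979, §1 Thm. 1.7, Cor. 1.11, §2 Cor. 2.5, Remark 2.11 and §3 (p. 107–108)]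
[cite: Arapura2006, §1 Lemma 1.3 and §4 Lemma 4.2] [cite: Hartshorne1977, I Ex. 5.5] -/
theorem hc_fermatHypersurface_powers_of_hc_av (hAV : HC_AV) (hn : 1 ≤ n) (hm : 1 ≤ m)
    (hSK : IsDominatedByPowers n (fermatHypersurface n m) 1 (fermatHypersurface 1 m)) :
    HodgeConjectureFor n (fermatHypersurface n m) ∧
      ∀ k : ℕ, HodgeConjectureFor ((k + 1) * n) ((fermatHypersurface n m).pow (k + 1)) :=
  hc_of_isDominatedByPowers_curve hAV (isSmoothProjective_fermatHypersurface le_rfl hm)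
    (isSmoothProjective_fermatHypersurface hn hm) hSK

/-- The same for EVERY Fermat variety `X` of dimension `n ≥ 1` and degree `m ≥ 1` in the sense of
`Motives.IsFermatVariety` (each is isomorphic over `ℂ` to the standard model, `IsFermatVariety.isoFermatHypersurface`,
and `HodgeConjectureFor` is invariant under isomorphism, `hodgeConjectureFor_iff_of_iso'`): GIVEN `HC_AV` and the
Shioda–Katsura domination `hSK` of the standard model, the Hodge conjecture holds for `X`.
[cite: Shioda1979PJA, §2 Thm. 1 and Thm. 2] [cite: ShiodaKatsura1979, §3 (p. 107–108)] [cite: Hartshorne1977, II Ex. 3.11 (d)] -/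
theorem hc_of_isFermatVariety_of_hc_av (hAV : HC_AV) (hn : 1 ≤ n) (hm : 1 ≤ m) (hF : IsFermatVariety n m X)
    (hSK : IsDominatedByPowers n (fermatHypersurface n m) 1 (fermatHypersurface 1 m)) :
    HodgeConjectureFor n X :=
  (hodgeConjectureFor_iff_of_iso' hF.isoFermatHypersurface).2 (hc_fermatHypersurface_powers_of_hc_av hAV hn hm hSK).1

/-- **Products of Fermat hypersurfaces of ANY two degrees, with all powers** (Shioda 1979 Thm. 2 is the case of a
common degree `m`, under his condition; here from `HC_AV`): GIVEN `HC_AV` and the Shioda–Katsura dominations of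
`Xⁿ¹_{m₁}` by `X¹_{m₁}` and of `Xⁿ²_{m₂}` by `X¹_{m₂}`, the Hodge conjecture holds for `Xⁿ¹_{m₁} × Xⁿ²_{m₂}` and all its
powers (each factor is dominated by a Fermat Jacobian, the product by the product abelian variety:
`exists_isDominatedByPowers_tensor`; the product dominates itself, `isDominatedByPowers_self`).
[cite: Shioda1979PJA, §2 Thm. 2 and §4 (p. 114)] [cite: ShiodaKatsura1979, §3 (p. 107–108)]
[cite: Arapura2006, §1 Lemma 1.1, Lemma 1.3 and §4 Lemma 4.2] -/
theorem hc_fermatHypersurface_tensor_powers_of_hc_av (hAV : HC_AV) (hn₁ : 1 ≤ n₁) (hm₁ : 1 ≤ m₁)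
    (hn₂ : 1 ≤ n₂) (hm₂ : 1 ≤ m₂)
    (hSK₁ : IsDominatedByPowers n₁ (fermatHypersurface n₁ m₁) 1 (fermatHypersurface 1 m₁))
    (hSK₂ : IsDominatedByPowers n₂ (fermatHypersurface n₂ m₂) 1 (fermatHypersurface 1 m₂)) :
    HodgeConjectureFor (n₁ + n₂) (fermatHypersurface n₁ m₁ ⊗ fermatHypersurface n₂ m₂) ∧
      ∀ k : ℕ, HodgeConjectureFor ((k + 1) * (n₁ + n₂))
        ((fermatHypersurface n₁ m₁ ⊗ fermatHypersurface n₂ m₂).pow (k + 1)) := by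
  have hX₁ : IsSmoothProjective n₁ (fermatHypersurface n₁ m₁) := isSmoothProjective_fermatHypersurface hn₁ hm₁
  have hX₂ : IsSmoothProjective n₂ (fermatHypersurface n₂ m₂) := isSmoothProjective_fermatHypersurface hn₂ hm₂
  have h₁ : ∃ B : AbelianVariety ℂ, IsDominatedByPowers n₁ (fermatHypersurface n₁ m₁) B.dim B.X :=
    exists_isDominatedByPowers_of_isDominatedByPowers (isSmoothProjective_fermatHypersurface le_rfl hm₁) hX₁ hSK₁
      (exists_isDominatedByPowers_curve (isSmoothProjective_fermatHypersurface le_rfl hm₁))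
  have h₂ : ∃ B : AbelianVariety ℂ, IsDominatedByPowers n₂ (fermatHypersurface n₂ m₂) B.dim B.X :=
    exists_isDominatedByPowers_of_isDominatedByPowers (isSmoothProjective_fermatHypersurface le_rfl hm₂) hX₂ hSK₂
      (exists_isDominatedByPowers_curve (isSmoothProjective_fermatHypersurface le_rfl hm₂))
  exact hc_of_exists_isDominatedByPowers_abelianVariety hAV (hX₁.tensor_holds hX₂)
    (exists_isDominatedByPowers_tensor hX₁ hX₂ h₁ h₂)

end Fermat

end Summit.HodgeConjecture.CorCM.Stage4

end
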